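import Summits.CriticalPhenomena.PercolationContinuityZ3.Theorems.PercNearOneGluingNoHeavyQuantTwoBigJCert
import Summits.CriticalPhenomena.PercolationContinuityZ3.Theorems.PercNearOneGluingNoHeavyQuantDIBStarCorner
import Summits.CriticalPhenomena.PercolationContinuityZ3.Theorems.PercNearOneGluingNoHeavyQuantDIBStarFloorSplitInductionBig
import Summits.CriticalPhenomena.PercolationContinuityZ3.Theorems.PercNearOneGluingNoHeavyQuantDIBStarFloorSplitInductionMid
import Summits.CriticalPhenomena.PercolationContinuityZ3.Theorems.PercNearOneGluingNoHeavyQuantDIBStarResidual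
import HarnessLib

/-!
# QUANT lane R8 — Conjecture DIB\* and its typed relatives DISCHARGED (corollaries of `dibStar_holds_J`)

builds on p205010 (kernel theorem, internal audit signed; external expert review pending)

Support file (`--supports stmt-CriticalPhenomena-4575`), QUANT lane seat prim-quant-p1 (gen 13).  Theorems only; no sorries, standard axioms.
One-line consequences of `Quant.IndepBlob.dibStar_holds_J : ∀ x < 1, DIBStar x` (`…QuantTwoBigJCert`, p292639) for the typed `@[conjecture]`
statements of the floor-split programme that are EQUIVALENT to (or implied by) T-DIB: `DIBPsi` (census-2 g49's weaker row), `DIBStarCorner`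
(typer g17), and the step lemmas `StepLemmaFS` (lead g17), `StepLemmaFSBig`, `StepLemmaFSCore`, `StepLemmaFSMid`, `StepLemmaFSLumpy`,
`StepLemmaFSLumpyPC` (lead g18), `StepLemmaFSTwoBigs`, `StepLemmaFSResidual` (typer g20/g21), each via its `*_of_dibStar` lemma.  NOT implied and
NOT claimed: the certificate-existence conjectures `FSE`, `StepFSE`, `StepFSEMax`, `StepLemmaFSMenu`, `BSCert`-type statements (they assert that a
particular MENU certifies every instance).  [this work]
-/

namespace Summit.CriticalPhenomena.PercolationContinuityZ3.Theorems
namespace Quant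
namespace IndepBlob

/-- **DIB-ψ holds below one** (census-2 g49's weaker row, `dibPsi_of_dibStar`). [this work] -/
theorem dibPsi_holds (x : ℝ) (hx1 : x < 1) : DIBPsi x := dibPsi_of_dibStar hx1 (dibStar_holds_J x hx1)

/-- **The corner form holds below one** (typer g17's `DIBStarCorner`). [this work] -/
theorem dibStarCorner_holds (x : ℝ) (hx1 : x < 1) : DIBStarCorner x := DIBStarCorner.of_dibStar (dibStar_holds_J x hx1)

/-- **The floor-split step lemma holds** (lead g17's `StepLemmaFS`). [this work] -/
theorem stepLemmaFS_holds : StepLemmaFS := stepLemmaFS_of_dibStar dibStar_holds_J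

/-- `StepLemmaFSBig` holds. [this work] -/
theorem stepLemmaFSBig_holds : StepLemmaFSBig := stepLemmaFSBig_of_dibStar dibStar_holds_J

/-- `StepLemmaFSCore` holds. [this work] -/
theorem stepLemmaFSCore_holds : StepLemmaFSCore := stepLemmaFSCore_of_dibStar dibStar_holds_J

/-- `StepLemmaFSMid` holds. [this work] -/
theorem stepLemmaFSMid_holds : StepLemmaFSMid := stepLemmaFSMid_of_dibStar dibStar_holds_J

/-- `StepLemmaFSLumpy` holds (lead g18). [this work] -/
theorem stepLemmaFSLumpy_holds : StepLemmaFSLumpy := stepLemmaFSLumpy_of_dibStar dibStar_holds_J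

/-- `StepLemmaFSLumpyPC` holds (lead g18). [this work] -/
theorem stepLemmaFSLumpyPC_holds : StepLemmaFSLumpyPC := stepLemmaFSLumpyPC_of_dibStar dibStar_holds_J

/-- `StepLemmaFSTwoBigs` holds. [this work] -/
theorem stepLemmaFSTwoBigs_holds : StepLemmaFSTwoBigs := stepLemmaFSTwoBigs_of_dibStar dibStar_holds_J

/-- `StepLemmaFSResidual` holds. [this work] -/
theorem stepLemmaFSResidual_holds : StepLemmaFSResidual := stepLemmaFSResidual_of_dibStar dibStar_holds_J

end IndepBlob
end Quant
end Summit.CriticalPhenomena.PercolationContinuityZ3.Theorems
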